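import Summits.ResolutionOfSingularities.ResolutionOfSingularities.Theorems.MarkedTransferCampaignW46TypedProcedureAnchors
import HarnessLib

/-!
# [OURS · L1 W4.6 rung (i)] Termination of the typed Th. 16.6 procedure in a regime REDUCES to termination of
# all §2.1-permissible sequences in that regime; termination by a well-founded measure
# (cell res-hironaka, LADDER-RESOLUTION rung L, D-0089; campaign s46, prover res-L1-s46-pv-1; host route
# MarkedTransfer, `--supports stmt-ResolutionOfSingularities-16155`)

HONEST FRAMING. Nothing here is a statement of H. Hironaka's manuscript (2017-03-23, [Hironaka2017]) and nothing
here asserts that any statement of it holds. These are OURS definitions and THEOREMS OF PURE LOGIC about the OURS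
typed procedure of the shared campaign module `Theorems.MarkedTransferCampaignW46TypedProcedure` (res-L1-type-o1,
p465445) and its anchors (p465813): `CampaignW46.Run`, `Terminates`, `Step`, `Resume`. The typed CANDIDATE carriers
of rung S enter only through the résumé's HYPOTHESIS FIELDS (Def. 15.12 «`∇(E) ⊆ Sing(Ě) ⊆ Sing(E)`», used via
the anchor `IsCentre.isPermissibleCentre`) and the step data «`J(s) ≠ (0)`, `b(s) > 0`» (anchor
`Resume.mti_isStandard`). AI review is weaker than expert review. No `sorry`; axioms standard.

## What this file establishes (and why rung (i) needs it)

A run of the typed procedure posits a résumé at every stage; but whatever the notion instance `N` and the reading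
`Rd` are, the typed centre rule (`IsCentre`: `D ⊆ ∇(E)` smooth closed irreducible) together with the résumé's
Def. 15.12 inclusions makes every centre a §2.1-PERMISSIBLE centre for the current ideal exponent, and every
stage's ideal exponent is standard. Forgetting the résumés therefore maps a `Run N Rd` to a RÉSUMÉ-FREE object:

* `PermissibleRun p K` — an infinite sequence of ambient data `A k`, STANDARD ideal exponents `E k`, centres `D k`
  permissible for `E k` (row 001 `IdealExponent.IsPermissibleCentre`), blow-ups `π k : (A (k+1)).Z ⟶ (A k).Z`
  along `D k` over the same base field, with `E (k+1)` the transform (Def. 2.1); `Run.toPermissibleRun`.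
* `PermissiblyTerminates Rg` — «no infinite permissible sequence all of whose stages lie in the regime `Rg`».
* `terminates_of_permissiblyTerminates` — **`PermissiblyTerminates Rg → Terminates N Rd Rg` for EVERY `N`, `Rd`.**
  This is the route by which a restricted-regime rung can be proved WITHOUT deciding the semantics of the notion
  parameters (℘, core focusing, `Inv`): by a GEOMETRIC termination theorem for permissible sequences in the regime
  («Hauser–Wagner-type invariant as OUR proof», RESCUE-SEED W4.6). It also delimits the regimes for which such a
  rung can possibly hold for all `N`: a regime containing a state whose singular locus has a positive-dimensional
  component through which permissible point blow-ups can be iterated (e.g. `(𝓘_D, 1)` for a smooth divisor `D`,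
  or `((y^b), b)` in the plane) admits an infinite permissible sequence, so there `Terminates N Rd Rg` can only
  hold for instances `N` whose résumés FORBID such centres — the literal centre rule «any smooth closed
  irreducible `D ⊆ ∇(E)`» does not (recorded for res-L1-s46-plan-1 in the seat's notes; no claim about the
  manuscript is made here).
* `permissiblyTerminates_of_measure` / `terminates_of_measure` — termination from a measure with values in a
  well-founded relation that strictly decreases along every permissible transform (resp. every typed step)
  inside the regime: the interface a geometric invariant plugs into.
* `permissiblyTerminates_antitone`, `PermissibleRun.tail`, `terminates_iff_forall_not_eventually` — bookkeeping
  (shrinking the regime; runs have no preferred origin, so a regime need only fail cofinally... precisely: a run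
  that is EVENTUALLY inside `Rg` already contradicts `Terminates N Rd Rg`).

## References

* companion modules `MarkedTransferCampaignW46TypedProcedure` (docstring DESIGN POINTS (CTR), (REG), (VAC)) and
  `MarkedTransferCampaignW46TypedProcedureAnchors`; plan/RESCUE-SEED.md §1 row W4.6; plan/SIZED-ASK-L.md v0.2 §S.
* H. Hironaka, ms. 2017-03-23, Th. 16.6 p.84 l.4–9, §16.3 p.87 l.14–28 (Th. 16.13 «repeatedly but finitely many
  times»), §2.1 p.4 l.37–39, Def. 2.1 p.5, Def. 15.12 p.80 l.37 – p.81 l.2 — scope only, under adjudication, not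
  cited as fact. [Hironaka2017]
-/

noncomputable section

set_option linter.dupNamespace false -- mandated namespace of this single-conjunct summit

open CategoryTheory AlgebraicGeometry TopologicalSpace

namespace Summit.ResolutionOfSingularities.ResolutionOfSingularities.Theorems

namespace CampaignW46

open Literature.AlgebraicGeometry.Resolution
open Literature.AlgebraicGeometry.Hironaka2017.S02Preliminaries
open Literature.AlgebraicGeometry.Hironaka2017.Datum
open Literature.AlgebraicGeometry.Hironaka2017.S15ARSchemes
open Literature.AlgebraicGeometry.Hironaka2017.S16Proof

universe u

variable {n : ℕ} {p : ℕ} [Fact p.Prime] {K : Type u} [Field K] [CharP K p]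

/-! ## Résumé-free permissible sequences -/

/-- [OURS · L1 W4.6 rung (i)] NOT a statement of the manuscript. AN INFINITE §2.1-PERMISSIBLE SEQUENCE over `K`:
ambient data `A k` (smooth irreducible of finite type over `K`), STANDARD ideal exponents `E k` («`J ≠ (0)`,
`b > 0`», p.6 l.37–38), centres `D k` permissible for `E k` (§2.1 p.4 l.37–39: closed, irreducible, smooth over
`K`, `⊆ Sing(E k)`), blow-ups `π k` along (the reduced ideal of) `D k` onto the next ambient scheme over the same
base field, and `E (k+1)` the transform of `E k` (Def. 2.1). This is what is left of a run of the typed procedure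
when the résumés are forgotten (`Run.toPermissibleRun`). [folklore] -/
structure PermissibleRun (p : ℕ) [Fact p.Prime] (K : Type u) [Field K] [CharP K p] where
  /-- the ambient datum at stage `k` -/
  A : ℕ → AmbientDatum p K
  /-- the ideal exponent at stage `k` -/
  E : ∀ k, IdealExponent (A k).Z
  /-- the centre blown up at stage `k` -/
  D : ∀ k, Closeds (A k).Z
  /-- the blow-up morphism `Z_{k+1} ⟶ Z_k` -/
  π : ∀ k, (A (k + 1)).Z ⟶ (A k).Z
  /-- every `E k` is standard (`J ≠ (0)`, `b > 0`) -/
  standard : ∀ k, (E k).IsStandard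
  /-- the centre is permissible for `E k` (§2.1) -/
  permissible : ∀ k, (E k).IsPermissibleCentre (A k).hom (D k)
  /-- same base field -/
  hom_eq : ∀ k, (A (k + 1)).hom = π k ≫ (A k).hom
  /-- `π k` is the blowing up along the reduced ideal of `D k` -/
  blowup : ∀ k, IsBlowup (π k) (Scheme.IdealSheafData.vanishingIdeal (D k))
  /-- `E (k+1)` is the transform of `E k` (Def. 2.1) -/
  E_succ : ∀ k, E (k + 1) = (E k).transform (π k) (D k)

/-- [OURS · L1 W4.6 rung (i)] NOT a statement of the manuscript. «Every §2.1-permissible sequence all of whose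
stages lie in the regime `Rg` is finite»: there is no infinite permissible sequence inside `Rg`. A GEOMETRIC
statement (no résumés, no notion parameters); by `terminates_of_permissiblyTerminates` it implies
`Terminates N Rd Rg` for every `N`, `Rd`. [folklore] -/
def PermissiblyTerminates (Rg : Regime p K) : Prop :=
  ∀ r : PermissibleRun p K, (∀ k, Rg (r.A k) (r.E k)) → False

namespace PermissibleRun

/-- Pure logic: dropping the first stage of a permissible sequence. [folklore] -/
def tail (r : PermissibleRun p K) : PermissibleRun p K where
  A k := r.A (k + 1)
  E k := r.E (k + 1)
  D k := r.D (k + 1)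
  π k := r.π (k + 1)
  standard k := r.standard (k + 1)
  permissible k := r.permissible (k + 1)
  hom_eq k := r.hom_eq (k + 1)
  blowup k := r.blowup (k + 1)
  E_succ k := r.E_succ (k + 1)

/-- Pure logic: dropping the first `j` stages. [folklore] -/
def drop (r : PermissibleRun p K) : ℕ → PermissibleRun p K
  | 0 => r
  | j + 1 => (r.drop j).tail

/-- The ambient data of the shifted sequence. [folklore] -/
theorem drop_A (r : PermissibleRun p K) (j k : ℕ) : (r.drop j).A k = r.A (k + j) := by
  induction j generalizing k with
  | zero => rfl
  | succ j ih =>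
    show ((r.drop j).tail).A k = r.A (k + (j + 1))
    rw [show k + (j + 1) = (k + 1) + j by omega]
    exact ih (k + 1)

/-- The stages of the shifted sequence (as dependent pairs, to state the shift without casts). [folklore] -/
theorem drop_stage (r : PermissibleRun p K) (j k : ℕ) :
    (⟨(r.drop j).A k, (r.drop j).E k⟩ : Σ A : AmbientDatum p K, IdealExponent A.Z) = ⟨r.A (k + j), r.E (k + j)⟩ := by
  induction j generalizing k with
  | zero => rfl
  | succ j ih =>
    show (⟨((r.drop j).tail).A k, ((r.drop j).tail).E k⟩ : Σ A : AmbientDatum p K, IdealExponent A.Z) = _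
    rw [show k + (j + 1) = (k + 1) + j by omega]
    exact ih (k + 1)

end PermissibleRun

/-- Pure logic: shrinking the regime weakens permissible termination. [folklore] -/
theorem permissiblyTerminates_antitone {Rg₁ Rg₂ : Regime p K} (hle : ∀ A E, Rg₁ A E → Rg₂ A E)
    (h : PermissiblyTerminates Rg₂) : PermissiblyTerminates Rg₁ :=
  fun r hr => h r fun k => hle _ _ (hr k)

/-- Pure logic: a permissible sequence that is EVENTUALLY inside `Rg` already contradicts `PermissiblyTerminates Rg`
(shift it). [folklore] -/
theorem PermissiblyTerminates.not_eventually {Rg : Regime p K} (h : PermissiblyTerminates Rg)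
    (r : PermissibleRun p K) (j : ℕ) (hr : ∀ k, j ≤ k → Rg (r.A k) (r.E k)) : False := by
  refine h (r.drop j) fun k => ?_
  have hs := r.drop_stage j k
  have hk : Rg (r.A (k + j)) (r.E (k + j)) := hr (k + j) (by omega)
  -- transport along the equality of stages
  have : ∀ (s t : Σ A : AmbientDatum p K, IdealExponent A.Z), s = t → Rg t.1 t.2 → Rg s.1 s.2 := by
    rintro s t rfl h; exact h
  exact this ⟨(r.drop j).A k, (r.drop j).E k⟩ ⟨r.A (k + j), r.E (k + j)⟩ hs hk

/-! ## Forgetting the résumés of a run -/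

namespace Run

variable {N : Notions.{u} n} {Rd : Reading p K N}

/-- [OURS · L1 W4.6 rung (i)] NOT a statement of the manuscript. FORGETTING THE RÉSUMÉS: a run of the typed
procedure is an infinite §2.1-permissible sequence — every stage's ideal exponent is standard (anchor
`Resume.mti_isStandard`, from the step data of row 091) and every centre admitted by the typed rule `IsCentre` is
permissible for the stage's ideal exponent (anchor `IsCentre.isPermissibleCentre`, from the résumé's Def. 15.12
hypothesis fields `∇(E) ⊆ Sing(Ě) ⊆ Sing(E)`). [folklore] -/
def toPermissibleRun (r : Run N Rd) : PermissibleRun p K where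
  A := r.A
  E := r.E
  D k := (r.step k).D
  π k := (r.step k).π
  standard k := (r.R k).mti_isStandard.1
  permissible k := (r.step k).centre.isPermissibleCentre
  hom_eq k := (r.step k).hom_eq
  blowup k := (r.step k).blowup
  E_succ k := r.E_succ k

/-- The forgetful map does not change the stages. [folklore] -/
@[simp] theorem toPermissibleRun_A (r : Run N Rd) (k : ℕ) : r.toPermissibleRun.A k = r.A k := rfl

/-- The forgetful map does not change the ideal exponents. [folklore] -/
@[simp] theorem toPermissibleRun_E (r : Run N Rd) (k : ℕ) : r.toPermissibleRun.E k = r.E k := rfl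

end Run

/-- **Reduction (pure logic).** [OURS · L1 W4.6 rung (i)] NOT a statement of the manuscript. For EVERY notion
instance `N` and EVERY reading `Rd`: if no infinite §2.1-permissible sequence lies inside the regime `Rg`, then
the typed Th. 16.6 procedure terminates in `Rg` (`Terminates N Rd Rg`). The résumés' content used: Def. 15.12
inclusions (centres are permissible) and «`J ≠ (0)`, `b > 0`» (stages are standard) — nothing about ℘, core
focusing or `Inv`. [folklore] -/
theorem terminates_of_permissiblyTerminates (N : Notions.{u} n) (Rd : Reading p K N) {Rg : Regime p K}
    (h : PermissiblyTerminates Rg) : Terminates N Rd Rg :=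
  fun r hr => h r.toPermissibleRun hr

/-- Pure logic: a run of the typed procedure that is EVENTUALLY inside `Rg` contradicts `Terminates N Rd Rg` (the
regime need not hold at the first stages: shift the run with `Run.tail`). [folklore] -/
theorem Terminates.not_eventually {N : Notions.{u} n} {Rd : Reading p K N} {Rg : Regime p K}
    (h : Terminates N Rd Rg) (r : Run N Rd) (j : ℕ) (hr : ∀ k, j ≤ k → Rg (r.A k) (r.E k)) : False := by
  induction j generalizing r with
  | zero => exact h r fun k => hr k (Nat.zero_le k)
  | succ j ih =>
    exact ih r.tail fun k hk => hr (k + 1) (by omega)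

/-- Pure logic: `Terminates N Rd Rg` is equivalent to «no run is eventually inside `Rg`». [folklore] -/
theorem terminates_iff_forall_not_eventually {N : Notions.{u} n} {Rd : Reading p K N} {Rg : Regime p K} :
    Terminates N Rd Rg ↔ ∀ (r : Run N Rd) (j : ℕ), ¬ ∀ k, j ≤ k → Rg (r.A k) (r.E k) :=
  ⟨fun h r j hr => h.not_eventually r j hr, fun h r hr => h r 0 fun k _ => hr k⟩

/-! ## Termination by a well-founded measure -/

/-- **Termination by a measure, permissible form (pure logic).** [OURS · L1 W4.6 rung (i)] NOT a statement of the
manuscript. Let `rel` be a well-founded relation on a type `α` and `μ` a measure of states `(A, E)`. If every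
permissible transform INSIDE the regime — `E` standard in `Rg` on `A`, `D` a §2.1-permissible centre for `E`,
`π : A'.Z ⟶ A.Z` a blow-up along `D` over the same base field, and the transform `E′` again in `Rg` — satisfies
`rel (μ A' E′) (μ A E)`, then no infinite permissible sequence lies in `Rg`. This is the slot for a geometric
(Hauser–Wagner-type) invariant. [folklore] -/
theorem permissiblyTerminates_of_measure {α : Type*} {rel : α → α → Prop} (hwf : WellFounded rel)
    {Rg : Regime p K} (μ : ∀ A : AmbientDatum p K, IdealExponent A.Z → α)
    (hdec : ∀ (A : AmbientDatum p K) (E : IdealExponent A.Z), Rg A E → E.IsStandard →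
      ∀ (D : Closeds A.Z), E.IsPermissibleCentre A.hom D →
      ∀ (A' : AmbientDatum p K) (π : A'.Z ⟶ A.Z), A'.hom = π ≫ A.hom →
        IsBlowup π (Scheme.IdealSheafData.vanishingIdeal D) → Rg A' (E.transform π D) →
          rel (μ A' (E.transform π D)) (μ A E)) :
    PermissiblyTerminates Rg := by
  intro r hr
  have hchain : ∀ k, rel (μ (r.A (k + 1)) (r.E (k + 1))) (μ (r.A k) (r.E k)) := by
    intro k
    have hk := hdec (r.A k) (r.E k) (hr k) (r.standard k) (r.D k) (r.permissible k) (r.A (k + 1)) (r.π k)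
      (r.hom_eq k) (r.blowup k)
    rw [← r.E_succ k] at hk
    exact hk (hr (k + 1))
  exact (wellFounded_iff_isEmpty_descending_chain.1 hwf).false
    ⟨fun k => μ (r.A k) (r.E k), hchain⟩

/-- **Termination by a measure, typed-step form (pure logic).** [OURS · L1 W4.6 rung (i)] NOT a statement of the
manuscript. The same with a measure that may also read the résumé (e.g. an `Inv`-string functional), decreasing
along every typed `Step` inside the regime between résumés read by `Rd`. [folklore] -/
theorem terminates_of_measure {N : Notions.{u} n} {Rd : Reading p K N} {α : Type*} {rel : α → α → Prop}
    (hwf : WellFounded rel) {Rg : Regime p K}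
    (μ : ∀ (A : AmbientDatum p K) (E : IdealExponent A.Z), Resume N A E → α)
    (hdec : ∀ (A : AmbientDatum p K) (E : IdealExponent A.Z) (R : Resume N A E), Rg A E → Rd A E R →
      ∀ (A' : AmbientDatum p K) (s : Step R A') (R' : Resume N A' s.E'), Rg A' s.E' → Rd A' s.E' R' →
        rel (μ A' s.E' R') (μ A E R)) :
    Terminates N Rd Rg := by
  intro r hr
  -- the measure along the run, read at the résumés the run posits
  have hchain : ∀ k, rel (μ (r.A (k + 1)) (r.E (k + 1)) (r.R (k + 1))) (μ (r.A k) (r.E k) (r.R k)) := by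
    intro k
    -- rewrite stage `k+1` as the transform by step `k`
    have key : ∀ (E₁ : IdealExponent (r.A (k + 1)).Z) (hE : E₁ = (r.step k).E') (R₁ : Resume N (r.A (k + 1)) E₁),
        Rg (r.A (k + 1)) E₁ → Rd (r.A (k + 1)) E₁ R₁ →
          rel (μ (r.A (k + 1)) E₁ R₁) (μ (r.A k) (r.E k) (r.R k)) := by
      rintro E₁ rfl R₁ hRg hRd
      exact hdec (r.A k) (r.E k) (r.R k) (hr k) (r.reads k) (r.A (k + 1)) (r.step k) R₁ hRg hRd
    exact key (r.E (k + 1)) (r.E_succ k) (r.R (k + 1)) (hr (k + 1)) (r.reads (k + 1))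
  exact (wellFounded_iff_isEmpty_descending_chain.1 hwf).false
    ⟨fun k => μ (r.A k) (r.E k) (r.R k), hchain⟩

/-- Pure logic: the permissible form through the forgetful map — a measure on states decreasing along permissible
transforms inside `Rg` gives `Terminates N Rd Rg` for every `N`, `Rd`. [folklore] -/
theorem terminates_of_stateMeasure (N : Notions.{u} n) (Rd : Reading p K N) {α : Type*} {rel : α → α → Prop}
    (hwf : WellFounded rel) {Rg : Regime p K} (μ : ∀ A : AmbientDatum p K, IdealExponent A.Z → α)
    (hdec : ∀ (A : AmbientDatum p K) (E : IdealExponent A.Z), Rg A E → E.IsStandard →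
      ∀ (D : Closeds A.Z), E.IsPermissibleCentre A.hom D →
      ∀ (A' : AmbientDatum p K) (π : A'.Z ⟶ A.Z), A'.hom = π ≫ A.hom →
        IsBlowup π (Scheme.IdealSheafData.vanishingIdeal D) → Rg A' (E.transform π D) →
          rel (μ A' (E.transform π D)) (μ A E)) :
    Terminates N Rd Rg :=
  terminates_of_permissiblyTerminates N Rd (permissiblyTerminates_of_measure hwf μ hdec)

end CampaignW46

end Summit.ResolutionOfSingularities.ResolutionOfSingularities.Theorems

end
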